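import Literature.MathematicalPhysics.QuantumLattice.PeriodicEquilibriumStatesPerturbationRows
import Literature.MathematicalPhysics.QuantumLattice.HubbardTTPrimeEquilibriumStatesNoPairing
import HarnessLib

/-!
# The Mermin–Wagner theorem for PERIODIC equilibrium states in two dimensions: no density wave, pair-density wave, spiral or
# striped order of any period breaks a continuous on-site symmetry at `T > 0` (Klein–Landau–Shucker for lattice fermions)

Topic `Literature/MathematicalPhysics/QuantumLattice` (family `hubbard`; the `q`-periodic twin of `MerminWagnerCriterionEquilibriumStates` /
`MerminWagnerEquilibriumStates2D` / `HubbardTTPrimeEquilibriumStatesNoPairing`, fed by the Bogoliubov inequality for periodic equilibrium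
states of `PeriodicEquilibriumStatesPerturbationRows`).

**Klein–Landau–Shucker, J. Stat. Phys. 26 (1981) 505, Theorem**: *in two dimensions every equilibrium (KMS) state of a finite-range
interaction invariant under a continuous one-parameter group of internal symmetries generated by an on-site charge is invariant under that
group* — with NO homogeneity assumption on the state. The tree's `MerminWagnerEquilibriumStates2D` proves the translation-invariant case
(translation-invariant solutions of the variational principle). This file proves it for every **`q`-PERIODIC equilibrium state**
`ω.IsPerVarEquilibrium β q Ψ R` (`PeriodicVariationalEquilibria`: `ω` `q`-periodic, `s̄(ω) − β ē_q(ω) = P_q(β,Ψ)`), for every period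
vector `q`, i.e. for exactly the states in which Néel, striped, spiral, charge-density-wave or pair-density-wave order would be seen
by a ONE-point function:

* §1 the abstract criterion (`IsPerVarEquilibrium.norm_sq_expect_le_of_double_commutator`,
  `…expect_eq_zero_of_small_double_commutators`): `|κ|²|ω(O)|² ≤ β‖O‖²‖C̃ᴴ[H_{Λ'},C̃] − [H_{Λ'},C̃]C̃ᴴ‖` whenever `C Õ − Õ C = κÕ`;
* §2 the criterion for a conserved even Hermitian on-site charge `q₀` (`…norm_sq_expect_le_of_conservedCharge`,
  `…expect_eq_zero_of_conservedCharge`), §3 the two-dimensional theorem (`…expect_eq_zero_of_conservedCharge_two`): for `Ψ` Hermitian,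
  even, translation covariant of finite range `R` on `ℤ²` with `Q_Z Φ(Z) = Φ(Z) Q_Z`, every `β ≥ 0`, every `q` and every `q`-periodic
  equilibrium state `ω`: `ω(O) = 0` for every local `O` with `Q_Λ O − O Q_Λ = κO`, `κ ≠ 0`;
* §4 the 2D `t–t'` Hubbard model `gcInteractionTT' t t' U μ h` (any `t, t', U, μ, h`, any `β ≥ 0`, any period `q`): every `q`-periodic
  equilibrium state annihilates every local observable of nonzero particle number (`…expect_eq_zero_of_numberCharged_ttPrime`) or nonzero
  spin imbalance (`…_spinCharged_ttPrime`); in particular **every pair amplitude `ω(c_p c_q)` vanishes**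
  (`…expect_annihilation_mul_annihilation_eq_zero_ttPrime`) — no superconducting or PAIR-DENSITY-WAVE order of any period — and every
  transverse spin amplitude `ω(S^±_x)` vanishes (no planar spiral / planar Néel order of any period).

(The longitudinal statement at `h = 0` — `ω(S^z_x) = 0` for every periodic equilibrium state of the `SU(2)`-symmetric model, i.e. no Néel
or stripe magnetisation — needs the spin-flip charge `S⁺ + S⁻`; it is the subject of a sequel.) Everything is PROVED (standard axioms);
no new definition, no named fact.

## The proof

Bogoliubov's inequality for periodic equilibrium states (`IsPerVarEquilibrium.bogoliubov_inequality`) replaces the translation-invariant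
one; everything else (`weightedCharge`, the double-commutator bound `norm_doubleCommutator_weightedCharge_localHamiltonian_le`,
`FermionInteraction.sum_norm_mul_sq_sum_le`, the logarithmic cutoff `exists_logCutoff_data`, the Hubbard charges `numberCharge` /
`spinCharge` and their conservation `commute_chargeSum_numberCharge_gcInteractionTT'` / `…spinCharge…`) is state-independent and reused
verbatim from the translation-invariant files.

## References

* A. Klein, L. J. Landau, D. S. Shucker, *On the absence of spontaneous breakdown of continuous symmetry for equilibrium states in two
  dimensions*, J. Stat. Phys. 26 (1981) 505–512. [cite: KleinLandauShucker1981]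
* F. J. Dyson, E. H. Lieb, B. Simon, J. Stat. Phys. 18 (1978) 335, §2 eq. (28). [cite: DLS1978, §2 eq. (28)]
* T. Koma, H. Tasaki, Phys. Rev. Lett. 68 (1992) 3248 (no pairing / magnetic order in 1D/2D Hubbard models at `T > 0`).
  [cite: KomaTasakiPRL1992, p. 3]
* H. Araki, H. Moriya, Rev. Math. Phys. 15 (2003) 93, Thm. 12.11. [cite: ArakiMoriya2003, Theorem 12.11]
* R. B. Israel, *Convexity in the Theory of Lattice Gases* (1979), Thm. I.2.4. [cite: Israel1979, Thm. I.2.4]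
-/

noncomputable section

open scoped ComplexOrder BigOperators Matrix.Norms.L2Operator
open Finset Literature.InformationTheory.Entropy

namespace Literature.MathematicalPhysics.QuantumLattice

open Matrix Literature.Probability.LatticeModels ThermodynamicLimit
open _root_.Filter
open scoped _root_.Topology

variable {d : ℕ}

/-! ### §1 The abstract criterion for periodic equilibrium states -/

section Criterion

variable (hd : 0 < d) {Ψ : FermionInteraction d} {R : ℝ} (hH : Ψ.IsHermitian) (hE : Ψ.IsEven)
  (hT : Ψ.IsTranslationInvariant) (hR : Ψ.HasFiniteRange R) {β : ℝ} (hβ : 0 ≤ β) {q : Fin d → ℕ} {ω : InfVolFermionState d}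
include hd hH hE hT hR hβ

/-- **QUANTITATIVE BOGOLIUBOV BOUND ON A CHARGED ONE-POINT FUNCTION, periodic equilibrium states**: if `C ∈ 𝔄_{Λ₁}` satisfies
`C Õ − Õ C = κ Õ` (`Õ = Γ_{Λ⊆Λ₁}O`) then, for `Λ' ⊇ thicken Λ₁ R` and `C̃ = Γ_{Λ₁⊆Λ'}C`,
`|κ|² |ω(O)|² ≤ β ‖O‖² ‖C̃ᴴ(H_{Λ'}C̃ − C̃H_{Λ'}) − (H_{Λ'}C̃ − C̃H_{Λ'})C̃ᴴ‖`. [cite: KleinLandauShucker1981] [cite: DLS1978, §2 eq. (28)] -/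
theorem InfVolFermionState.IsPerVarEquilibrium.norm_sq_expect_le_of_double_commutator (h : ω.IsPerVarEquilibrium β q Ψ R)
    {Λ Λ₁ Λ' : Finset (Site d)} (h₁ : Λ ⊆ Λ₁) (hΛR : thicken Λ₁ R ⊆ Λ') (O : FermionOp Λ) {κ : ℂ} (C : FermionOp Λ₁)
    (hCO : C * fermionEmbed (PolySite.incl h₁) O - fermionEmbed (PolySite.incl h₁) O * C = κ • fermionEmbed (PolySite.incl h₁) O) :
    ‖κ‖ ^ 2 * ‖ω.expect Λ O‖ ^ 2 ≤ β * ‖O‖ ^ 2 *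
      ‖(fermionEmbed (PolySite.incl ((subset_thicken Λ₁ R).trans hΛR)) C)ᴴ *
            (Ψ.localHamiltonian Λ' * fermionEmbed (PolySite.incl ((subset_thicken Λ₁ R).trans hΛR)) C -
              fermionEmbed (PolySite.incl ((subset_thicken Λ₁ R).trans hΛR)) C * Ψ.localHamiltonian Λ') -
          (Ψ.localHamiltonian Λ' * fermionEmbed (PolySite.incl ((subset_thicken Λ₁ R).trans hΛR)) C -
              fermionEmbed (PolySite.incl ((subset_thicken Λ₁ R).trans hΛR)) C * Ψ.localHamiltonian Λ') *
            (fermionEmbed (PolySite.incl ((subset_thicken Λ₁ R).trans hΛR)) C)ᴴ‖ := by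
  set Γ' := fermionEmbed (PolySite.incl ((subset_thicken Λ₁ R).trans hΛR)) with hΓ'
  set H := Ψ.localHamiltonian Λ' with hHdef
  set O₁ := fermionEmbed (PolySite.incl h₁) O with hO₁
  set D := (Γ' C)ᴴ * (H * Γ' C - Γ' C * H) - (H * Γ' C - Γ' C * H) * (Γ' C)ᴴ with hD
  have hB := h.bogoliubov_inequality hd hH hE hT hR hβ hΛR O₁ C
  rw [← hΓ', ← hHdef] at hB
  have hcomm : Γ' C * Γ' O₁ - Γ' O₁ * Γ' C = κ • Γ' O₁ := by
    rw [← map_mul, ← map_mul, ← map_sub, hCO, map_smul]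
  have hωO : ω.expect Λ' (Γ' O₁) = ω.expect Λ O := by
    rw [hΓ', hO₁, fermionEmbed_incl_fermionEmbed_incl]
    exact ω.compatible _ O
  rw [hcomm, map_smul, smul_eq_mul, hωO, norm_mul, mul_pow] at hB
  have hP : (ω.expect Λ' (Γ' O₁ * (Γ' O₁)ᴴ + (Γ' O₁)ᴴ * Γ' O₁)).re ≤ 2 * ‖O‖ ^ 2 := by
    have hn : ‖Γ' O₁‖ ≤ ‖O‖ := (norm_fermionEmbed_le _ _).trans (norm_fermionEmbed_le _ _)
    have h1 : (ω.expect Λ' (Γ' O₁ * (Γ' O₁)ᴴ + (Γ' O₁)ᴴ * Γ' O₁)).re ≤ ‖Γ' O₁ * (Γ' O₁)ᴴ + (Γ' O₁)ᴴ * Γ' O₁‖ :=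
      (Complex.re_le_norm _).trans (ω.norm_expect_le Λ' _)
    have h2 : ‖Γ' O₁ * (Γ' O₁)ᴴ + (Γ' O₁)ᴴ * Γ' O₁‖ ≤ ‖Γ' O₁‖ * ‖Γ' O₁‖ + ‖Γ' O₁‖ * ‖Γ' O₁‖ := by
      refine (norm_add_le _ _).trans (add_le_add ?_ ?_)
      · exact (norm_mul_le _ _).trans (by rw [Matrix.l2_opNorm_conjTranspose])
      · exact (norm_mul_le _ _).trans (by rw [Matrix.l2_opNorm_conjTranspose])
    have h3 : ‖Γ' O₁‖ * ‖Γ' O₁‖ ≤ ‖O‖ * ‖O‖ := mul_le_mul hn hn (norm_nonneg _) (norm_nonneg _)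
    nlinarith
  have hP0 : 0 ≤ (ω.expect Λ' (Γ' O₁ * (Γ' O₁)ᴴ + (Γ' O₁)ᴴ * Γ' O₁)).re := by
    have ha : 0 ≤ (ω.expect Λ' (Γ' O₁ * (Γ' O₁)ᴴ)).re := by
      have h' := ω.expect_nonneg Λ' (Γ' O₁)ᴴ
      rw [conjTranspose_conjTranspose] at h'
      exact (Complex.nonneg_iff.1 h').1
    have hb : 0 ≤ (ω.expect Λ' ((Γ' O₁)ᴴ * Γ' O₁)).re := (Complex.nonneg_iff.1 (ω.expect_nonneg Λ' (Γ' O₁))).1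
    rw [map_add, Complex.add_re]; exact add_nonneg ha hb
  have hQ : (ω.expect Λ' D).re ≤ ‖D‖ := (Complex.re_le_norm _).trans (ω.norm_expect_le Λ' _)
  have hβP : 0 ≤ β / 2 * (ω.expect Λ' (Γ' O₁ * (Γ' O₁)ᴴ + (Γ' O₁)ᴴ * Γ' O₁)).re := mul_nonneg (by positivity) hP0
  calc ‖κ‖ ^ 2 * ‖ω.expect Λ O‖ ^ 2
      ≤ β / 2 * (ω.expect Λ' (Γ' O₁ * (Γ' O₁)ᴴ + (Γ' O₁)ᴴ * Γ' O₁)).re * (ω.expect Λ' D).re := hB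
    _ ≤ β / 2 * (ω.expect Λ' (Γ' O₁ * (Γ' O₁)ᴴ + (Γ' O₁)ᴴ * Γ' O₁)).re * ‖D‖ := mul_le_mul_of_nonneg_left hQ hβP
    _ ≤ β / 2 * (2 * ‖O‖ ^ 2) * ‖D‖ := by
        refine mul_le_mul_of_nonneg_right (mul_le_mul_of_nonneg_left hP (by positivity)) (norm_nonneg _)
    _ = β * ‖O‖ ^ 2 * ‖D‖ := by ring

/-- **THE MERMIN–WAGNER CRITERION FOR PERIODIC EQUILIBRIUM STATES**: let `O ∈ 𝔄_Λ` and `κ ≠ 0`; if for every `ε > 0` there are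
`Λ ⊆ Λ₁`, `thicken Λ₁ R ⊆ Λ'` and `C ∈ 𝔄_{Λ₁}` with `C Õ − Õ C = κ Õ` and `‖C̃ᴴ[H_{Λ'},C̃] − [H_{Λ'},C̃]C̃ᴴ‖ ≤ ε`, then `ω(O) = 0`.
[cite: KleinLandauShucker1981] [cite: DLS1978, §2 eq. (28)] [cite: ArakiMoriya2003, Theorem 12.11] -/
theorem InfVolFermionState.IsPerVarEquilibrium.expect_eq_zero_of_small_double_commutators (h : ω.IsPerVarEquilibrium β q Ψ R)
    {Λ : Finset (Site d)} (O : FermionOp Λ) {κ : ℂ} (hκ : κ ≠ 0)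
    (hgen : ∀ ε : ℝ, 0 < ε → ∃ (Λ₁ : Finset (Site d)) (h₁ : Λ ⊆ Λ₁) (Λ' : Finset (Site d)) (hΛR : thicken Λ₁ R ⊆ Λ')
      (C : FermionOp Λ₁),
        C * fermionEmbed (PolySite.incl h₁) O - fermionEmbed (PolySite.incl h₁) O * C = κ • fermionEmbed (PolySite.incl h₁) O ∧
        ‖(fermionEmbed (PolySite.incl ((subset_thicken Λ₁ R).trans hΛR)) C)ᴴ *
              (Ψ.localHamiltonian Λ' * fermionEmbed (PolySite.incl ((subset_thicken Λ₁ R).trans hΛR)) C -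
                fermionEmbed (PolySite.incl ((subset_thicken Λ₁ R).trans hΛR)) C * Ψ.localHamiltonian Λ') -
            (Ψ.localHamiltonian Λ' * fermionEmbed (PolySite.incl ((subset_thicken Λ₁ R).trans hΛR)) C -
                fermionEmbed (PolySite.incl ((subset_thicken Λ₁ R).trans hΛR)) C * Ψ.localHamiltonian Λ') *
              (fermionEmbed (PolySite.incl ((subset_thicken Λ₁ R).trans hΛR)) C)ᴴ‖ ≤ ε) :
    ω.expect Λ O = 0 := by
  have key : ∀ ε : ℝ, 0 < ε → ‖κ‖ ^ 2 * ‖ω.expect Λ O‖ ^ 2 ≤ β * ‖O‖ ^ 2 * ε := by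
    intro ε hε
    obtain ⟨Λ₁, h₁, Λ', hΛR, C, hCO, hD⟩ := hgen ε hε
    exact (h.norm_sq_expect_le_of_double_commutator hd hH hE hT hR hβ h₁ hΛR O C hCO).trans
      (mul_le_mul_of_nonneg_left hD (by positivity))
  have h0 : ‖κ‖ ^ 2 * ‖ω.expect Λ O‖ ^ 2 ≤ 0 := by
    by_contra h'
    rw [not_le] at h'
    set X := ‖κ‖ ^ 2 * ‖ω.expect Λ O‖ ^ 2 with hX
    set K := β * ‖O‖ ^ 2 with hK
    have hK0 : 0 ≤ K := by positivity
    have h1 := key (X / (2 * (K + 1))) (by positivity)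
    have h2 : K * (X / (2 * (K + 1))) ≤ (K + 1) * (X / (2 * (K + 1))) :=
      mul_le_mul_of_nonneg_right (by linarith) (by positivity)
    have h3 : (K + 1) * (X / (2 * (K + 1))) = X / 2 := by
      field_simp
    linarith
  have hκ2 : 0 < ‖κ‖ ^ 2 := by positivity
  have h1 : ‖ω.expect Λ O‖ ^ 2 ≤ 0 := by
    by_contra h'; rw [not_le] at h'; nlinarith
  have h2 : ‖ω.expect Λ O‖ = 0 := by nlinarith [norm_nonneg (ω.expect Λ O), sq_nonneg ‖ω.expect Λ O‖]
  exact norm_eq_zero.1 h2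

end Criterion

/-! ### §2 The criterion for a conserved on-site charge -/

section Conserved

variable (hd : 0 < d) {Ψ : FermionInteraction d} {R : ℝ} (hH : Ψ.IsHermitian) (hE : Ψ.IsEven)
  (hT : Ψ.IsTranslationInvariant) (hR : Ψ.HasFiniteRange R) {β : ℝ} (hβ : 0 ≤ β) {q : Fin d → ℕ} {ω : InfVolFermionState d}
include hd hH hE hT hR hβ

/-- **QUANTITATIVE ORDER-PARAMETER BOUND FOR A CONSERVED ON-SITE CHARGE, periodic equilibrium states**: with `q₀` even Hermitian and
conserved term by term, `O` of charge `κ`, any `Λ₁ ⊇ Λ`, real weights `f ≡ 1` on `Λ`, `f ≡ 0` off `Λ₁`, constants `c_Z`: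
`|κ|²|ω(O)|² ≤ β‖O‖² · 4‖q₀‖² Σ_{Z ⊆ thicken Λ₁ R} ‖Φ(Z)‖ (Σ_{x∈Z}|f(x) − c_Z|)²`. [cite: KleinLandauShucker1981] [cite: DLS1978, §2 eq. (28)] -/
theorem InfVolFermionState.IsPerVarEquilibrium.norm_sq_expect_le_of_conservedCharge (h : ω.IsPerVarEquilibrium β q Ψ R)
    {q₀ : FermionOp ({0} : Finset (Site d))} (hq : q₀.IsHermitian) (hqe : parityAut q₀ = q₀)
    (hcons : ∀ Z : Finset (Site d), Commute (chargeSum q₀ Z) (Ψ.Φ Z))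
    {Λ : Finset (Site d)} (O : FermionOp Λ) {κ : ℂ} (hO : chargeSum q₀ Λ * O - O * chargeSum q₀ Λ = κ • O)
    {Λ₁ : Finset (Site d)} (h₁ : Λ ⊆ Λ₁) {f : Site d → ℝ} (hf1 : ∀ x ∈ Λ, f x = 1) (hf0 : ∀ x ∉ Λ₁, f x = 0)
    (c : Finset (Site d) → ℝ) :
    ‖κ‖ ^ 2 * ‖ω.expect Λ O‖ ^ 2 ≤ β * ‖O‖ ^ 2 *
      (4 * ‖q₀‖ ^ 2 * ∑ Z ∈ (thicken Λ₁ R).powerset, ‖Ψ.Φ Z‖ * (∑ x ∈ Z, |f x - c Z|) ^ 2) := by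
  have hCO : weightedCharge q₀ f Λ₁ * fermionEmbed (PolySite.incl h₁) O - fermionEmbed (PolySite.incl h₁) O * weightedCharge q₀ f Λ₁ =
      κ • fermionEmbed (PolySite.incl h₁) O := by
    rw [weightedCharge_commutator_fermionEmbed hqe h₁ hf1 O, hO, map_smul]
  refine (h.norm_sq_expect_le_of_double_commutator hd hH hE hT hR hβ h₁ le_rfl O (weightedCharge q₀ f Λ₁) hCO).trans ?_
  refine mul_le_mul_of_nonneg_left ?_ (by positivity)
  have hW : fermionEmbed (PolySite.incl ((subset_thicken Λ₁ R).trans le_rfl)) (weightedCharge q₀ f Λ₁) =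
      weightedCharge q₀ f (thicken Λ₁ R) :=
    fermionEmbed_incl_weightedCharge _ fun x _ hx => hf0 x hx
  rw [hW, conjTranspose_weightedCharge hq]
  exact norm_doubleCommutator_weightedCharge_localHamiltonian_le hqe hcons _ f c

/-- **MERMIN–WAGNER CRITERION FOR A CONSERVED ON-SITE CHARGE, periodic equilibrium states.** Let `q₀ ∈ 𝔄_{{0}}` be even and Hermitian,
conserved by every term of `Ψ`, and `O ∈ 𝔄_Λ` of charge `κ ≠ 0`. If for every `ε > 0` there are `Λ₁ ⊇ Λ`, weights `f ≡ 1` on `Λ`,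
`f ≡ 0` off `Λ₁`, and a modulus `b` with `|f(x) − f(y)| ≤ b(x)` for `‖y − x‖_∞ ≤ R` and `4‖q₀‖² |box ⌊R⌋| S_Ψ Σ_{x ∈ thicken Λ₁ R} b(x)² ≤ ε`,
then `ω(O) = 0` for every `q`-periodic equilibrium state `ω` at `β ≥ 0`. [cite: KleinLandauShucker1981] [cite: ArakiMoriya2003, Theorem 12.11] -/
theorem InfVolFermionState.IsPerVarEquilibrium.expect_eq_zero_of_conservedCharge (h : ω.IsPerVarEquilibrium β q Ψ R)
    {q₀ : FermionOp ({0} : Finset (Site d))} (hq : q₀.IsHermitian) (hqe : parityAut q₀ = q₀)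
    (hcons : ∀ Z : Finset (Site d), Commute (chargeSum q₀ Z) (Ψ.Φ Z))
    {Λ : Finset (Site d)} (O : FermionOp Λ) {κ : ℂ} (hκ : κ ≠ 0) (hO : chargeSum q₀ Λ * O - O * chargeSum q₀ Λ = κ • O)
    (hf : ∀ ε : ℝ, 0 < ε → ∃ (Λ₁ : Finset (Site d)) (_ : Λ ⊆ Λ₁) (f b : Site d → ℝ),
      (∀ x ∈ Λ, f x = 1) ∧ (∀ x ∉ Λ₁, f x = 0) ∧ (∀ x y : Site d, y - x ∈ box d ⌊R⌋₊ → |f x - f y| ≤ b x) ∧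
      4 * ‖q₀‖ ^ 2 * (((box d ⌊R⌋₊).card : ℝ) * (∑ X ∈ (thicken ({0} : Finset (Site d)) R).powerset with (0 : Site d) ∈ X, ‖Ψ.Φ X‖) *
        ∑ x ∈ thicken Λ₁ R, b x ^ 2) ≤ ε) :
    ω.expect Λ O = 0 := by
  refine h.expect_eq_zero_of_small_double_commutators hd hH hE hT hR hβ O hκ fun ε hε => ?_
  obtain ⟨Λ₁, h₁, f, b, hf1, hf0, hb, hε'⟩ := hf ε hε
  refine ⟨Λ₁, h₁, thicken Λ₁ R, le_rfl, weightedCharge q₀ f Λ₁, ?_, ?_⟩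
  · rw [weightedCharge_commutator_fermionEmbed hqe h₁ hf1 O, hO, map_smul]
  · have hW : fermionEmbed (PolySite.incl ((subset_thicken Λ₁ R).trans le_rfl)) (weightedCharge q₀ f Λ₁) =
        weightedCharge q₀ f (thicken Λ₁ R) :=
      fermionEmbed_incl_weightedCharge _ fun x _ hx => hf0 x hx
    rw [hW, conjTranspose_weightedCharge hq]
    obtain ⟨c, hc⟩ := Ψ.sum_norm_mul_sq_sum_le hT hR (thicken Λ₁ R) hb
    refine (norm_doubleCommutator_weightedCharge_localHamiltonian_le hqe hcons _ f c).trans (le_trans ?_ hε')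
    exact mul_le_mul_of_nonneg_left hc (by positivity)

end Conserved

/-! ### §3 Two dimensions -/

section TwoD

variable {Ψ : FermionInteraction 2} {R : ℝ} (hH : Ψ.IsHermitian) (hE : Ψ.IsEven)
  (hT : Ψ.IsTranslationInvariant) (hR : Ψ.HasFiniteRange R) {β : ℝ} (hβ : 0 ≤ β) {q : Fin 2 → ℕ} {ω : InfVolFermionState 2}
include hH hE hT hR hβ

/-- **MERMIN–WAGNER FOR PERIODIC EQUILIBRIUM STATES IN TWO DIMENSIONS (Klein–Landau–Shucker).** Let `Ψ` be a Hermitian, even,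
translation-covariant interaction of finite range `R` on `ℤ²` each of whose terms conserves the even Hermitian on-site charge `q₀`
(`Q_Z Φ(Z) = Φ(Z) Q_Z`), `β ≥ 0`, `q` any period vector and `ω` any `q`-periodic equilibrium state (`ω.IsPerVarEquilibrium β q Ψ R`).
Then `ω(O) = 0` for every local `O ∈ 𝔄_Λ` of nonzero charge (`Q_Λ O − O Q_Λ = κO`, `κ ≠ 0`): no periodic equilibrium state — of any
period — breaks the continuous symmetry generated by `q₀`. [cite: KleinLandauShucker1981] [cite: ArakiMoriya2003, Theorem 12.11] -/
theorem InfVolFermionState.IsPerVarEquilibrium.expect_eq_zero_of_conservedCharge_two (h : ω.IsPerVarEquilibrium β q Ψ R)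
    {q₀ : FermionOp ({0} : Finset (Site 2))} (hq : q₀.IsHermitian) (hqe : parityAut q₀ = q₀)
    (hcons : ∀ Z : Finset (Site 2), Commute (chargeSum q₀ Z) (Ψ.Φ Z))
    {Λ : Finset (Site 2)} (O : FermionOp Λ) {κ : ℂ} (hκ : κ ≠ 0) (hO : chargeSum q₀ Λ * O - O * chargeSum q₀ Λ = κ • O) :
    ω.expect Λ O = 0 := by
  refine h.expect_eq_zero_of_conservedCharge two_pos hH hE hT hR hβ hq hqe hcons O hκ hO fun ε hε => ?_
  obtain ⟨Λ₁, h₁, f, b, hf1, hf0, hb, hsum⟩ := exists_logCutoff_data Λ R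
    (K := 4 * ‖q₀‖ ^ 2 * (((box 2 ⌊R⌋₊).card : ℝ) *
      ∑ X ∈ (thicken ({0} : Finset (Site 2)) R).powerset with (0 : Site 2) ∈ X, ‖Ψ.Φ X‖)) (by positivity) hε
  refine ⟨Λ₁, h₁, f, b, hf1, hf0, hb, ?_⟩
  calc _ = 4 * ‖q₀‖ ^ 2 * (((box 2 ⌊R⌋₊).card : ℝ) *
        ∑ X ∈ (thicken ({0} : Finset (Site 2)) R).powerset with (0 : Site 2) ∈ X, ‖Ψ.Φ X‖) * ∑ x ∈ thicken Λ₁ R, b x ^ 2 := by ring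
    _ ≤ ε := hsum

end TwoD

/-! ### §4 The two-dimensional `t–t'` Hubbard model: no `U(1)` (pairing) or `S^z`-rotation breaking of any period -/

section Hubbard

variable (t t' U μ hz : ℝ) {β : ℝ} (hβ : 0 ≤ β) {q : Fin 2 → ℕ} {ω : InfVolFermionState 2}
include hβ

/-- **MERMIN–WAGNER FOR THE 2D `t–t'` HUBBARD MODEL, periodic equilibrium states, particle number**: for every `β ≥ 0`, every period
`q`, every `q`-periodic equilibrium state `ω` of `gcInteractionTT' t t' U μ h` and every local `O ∈ 𝔄_Λ` with `N_Λ O − O N_Λ = κO`,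
`κ ≠ 0`: `ω(O) = 0`. [cite: KleinLandauShucker1981] [cite: KomaTasakiPRL1992, p. 3] -/
theorem InfVolFermionState.IsPerVarEquilibrium.expect_eq_zero_of_numberCharged_ttPrime
    (h : ω.IsPerVarEquilibrium β q (gcInteractionTT' t t' U μ hz) 1) {Λ : Finset (Site 2)} (O : FermionOp Λ) {κ : ℂ} (hκ : κ ≠ 0)
    (hO : (totalNumber : FermionOp Λ) * O - O * totalNumber = κ • O) : ω.expect Λ O = 0 :=
  h.expect_eq_zero_of_conservedCharge_two (gcInteractionTT'_isHermitian t t' U μ hz) (gcInteractionTT'_isEven t t' U μ hz)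
    (gcInteractionTT'_isTranslationInvariant t t' U μ hz) (gcInteractionTT'_hasFiniteRange t t' U μ hz) hβ
    (numberCharge_isHermitian 2) (parityAut_numberCharge 2) (commute_chargeSum_numberCharge_gcInteractionTT' t t' U μ hz) O hκ
    (by rw [chargeSum_numberCharge]; exact hO)

/-- **… spin rotations about `z`**: `ω(O) = 0` for every local `O` with `(N↑_Λ − N↓_Λ) O − O (N↑_Λ − N↓_Λ) = κO`, `κ ≠ 0` (e.g.
`S^±_x`, `c_{x↑}c_{y↑}`), in every periodic equilibrium state: no planar (spiral, planar-Néel) magnetic order of any period.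
[cite: KleinLandauShucker1981] [cite: KomaTasakiPRL1992, p. 3] -/
theorem InfVolFermionState.IsPerVarEquilibrium.expect_eq_zero_of_spinCharged_ttPrime
    (h : ω.IsPerVarEquilibrium β q (gcInteractionTT' t t' U μ hz) 1) {Λ : Finset (Site 2)} (O : FermionOp Λ) {κ : ℂ} (hκ : κ ≠ 0)
    (hO : (spinImbalance : FermionOp Λ) * O - O * spinImbalance = κ • O) : ω.expect Λ O = 0 :=
  h.expect_eq_zero_of_conservedCharge_two (gcInteractionTT'_isHermitian t t' U μ hz) (gcInteractionTT'_isEven t t' U μ hz)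
    (gcInteractionTT'_isTranslationInvariant t t' U μ hz) (gcInteractionTT'_hasFiniteRange t t' U μ hz) hβ
    (spinCharge_isHermitian 2) (parityAut_spinCharge 2) (commute_chargeSum_spinCharge_gcInteractionTT' t t' U μ hz) O hκ
    (by rw [chargeSum_spinCharge]; exact hO)

/-- **NO PAIRING AMPLITUDE OF ANY PERIOD IN THE 2D `t–t'` HUBBARD MODEL AT ANY TEMPERATURE**: `ω(c_p c_q) = 0` for all orbitals `p, q`
of every finite region, in every `q`-periodic equilibrium state, for every period `q` — neither a uniform condensate nor a
PAIR-DENSITY WAVE (a pair amplitude modulated with any period) exists at `β < ∞`. [cite: KleinLandauShucker1981] [cite: KomaTasakiPRL1992, p. 3] -/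
theorem InfVolFermionState.IsPerVarEquilibrium.expect_annihilation_mul_annihilation_eq_zero_ttPrime
    (h : ω.IsPerVarEquilibrium β q (gcInteractionTT' t t' U μ hz) 1) {Λ : Finset (Site 2)} (p p' : Orb (PolySite Λ)) : ω.expect Λ (annihilation p * annihilation p') = 0 :=
  h.expect_eq_zero_of_numberCharged_ttPrime t t' U μ hz hβ _ (by norm_num : (-2 : ℂ) ≠ 0)
    (totalNumber_commutator_annihilation_mul_annihilation p p')

end Hubbard

end Literature.MathematicalPhysics.QuantumLattice

end
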